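import Literature.AlgebraicGeometry.Motives.PoincareUniversal.ModelTowerInstance
import Literature.AlgebraicGeometry.Modules.NilpotentFramePullback
import Literature.AlgebraicGeometry.Modules.PullbackQuasicoherent
import Literature.AlgebraicGeometry.Modules.RankOneDescentAlongH0Iso
import HarnessLib

/-!
# M13 — frames of `ℒ|` and `𝒫|` on the Artinian levels by nilpotent Nakayama (`framesL`, `framesP`)

The input `FL`/`FP` of the M13 model tower (`PoincareUniversal.ModelTowerInstance`, `GammaInputs`) along [MumfordAV1970] §13
(proof of the Theorem, pp. 125–130) and [GortzWedhorn2023] Lemma 24.72 (proof, Step (I): the thickenings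
`X ×_S Spec(𝒪_{S,s}/𝔪^{n+1})`): the one-step transition `levelτ n : A₀ × Spec(𝒪_{T,x}/𝔪^{n+1}) ↪ A₀ × Spec(𝒪_{T,x}/𝔪^{n+2})`
in the absolute flat-model currency (`absTransition` along the SURJECTIVE level map `πℂ n` with square-zero kernel —
`πℂ_surjective`, `isNilpotent_ker_πℂ`), and **frames climb one level** (`framesSucc`): frames of `N ≅ levelτ^*N'` on the pieces
`pr⁻¹V_a` give frames of the rank-one quasi-coherent `N'` one level up, by nilpotent Nakayama on the affine chart algebras
`Γ(V_a) ⊗ 𝒪/𝔪^{n+2} ↠ Γ(V_a) ⊗ 𝒪/𝔪^{n+1}` (★ `Modules.nonempty_frame_of_frame_pullback_of_nilpotent` with ★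
`absTransitionAppLE_surjective` / `isNilpotent_ker_absTransitionAppLE` / `isAffineOpen_fst_preimage`).  Whence, by induction from
frames at level `0`: `framesL` — frames of `ℒ|_{A₀ × Spec 𝒪_{T,t}/𝔪^{n+1}}` on `pr⁻¹V` for all `n` (`Llevelτ`, `τn_eq_levelτ`), and
`framesP` — frames of `𝒫|_{A₀ × Spec 𝒪_{Â,y₀}/𝔪^{n+1}}` for all `n` (`PBlevelτ`, `levelτ_jBn`).
Cell `hodgecm-mathlib`, M13 node N3 (3c) (γ4); source B-p20 (g7) v4 231f040e §§ Gamma4/Gamma4L, cut B-p20 (g8).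
HC_CM is proved only modulo the 7 printed citations until rung 0 closes.

## References
* [MumfordAV1970] D. Mumford, *Abelian Varieties*, §13 (proof of the Thm. pp. 125–130).
* [GortzWedhorn2023] U. Görtz, T. Wedhorn, *Algebraic Geometry II*, Lemma 24.72 (p. 409) and its proof, Step (I) (p. 410).
-/

noncomputable section

universe u v

open TensorProduct CategoryTheory AlgebraicGeometry
open Literature.RingTheory.Flat Literature.RingTheory.Flat.IsSmallExtension

namespace Literature.AlgebraicGeometry.Motives.AbelianVariety

open CategoryTheory CategoryTheory.Limits AlgebraicGeometry MonoidalCategory CartesianMonoidalCategory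
open Literature.AlgebraicGeometry.AbelianSchemes Literature.AlgebraicGeometry.AbelianVarieties
  Literature.AlgebraicGeometry.Modules Literature.AlgebraicGeometry.Morphisms
  Literature.AlgebraicGeometry.Morphisms.CechUnitCocycle IsLocalRing

section GammaInstance

variable (A₀ : AbelianVariety ℂ) {Θ : CartierDivisor A₀.X.left} (hΘ : Θ.IsAmple)
  (P : (A₀.X ⊗ (A₀.dualOf Θ hΘ).X).left.Modules)
  (T' : SchemeOver ℂ) (ℒ : (AbelianSchemeOver.ofAbelianVariety A₀).RigidifiedLineBundle T'.hom)
  (t : T'.left) [LocallyOfFiniteType T'.hom] [IsLocallyNoetherian T'.left] (ht : IsClosed ({t} : Set T'.left))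
  {ι : Type} (V : ι → A₀.X.left.Opens) (hV : ∀ a, IsAffineOpen (V a))
  (y₀ : (A₀.dualOf Θ hΘ).X.left) [LocallyOfFiniteType (A₀.dualOf Θ hΘ).X.hom]
  [IsLocallyNoetherian (A₀.dualOf Θ hΘ).X.left] (hy₀ : IsClosed ({y₀} : Set (A₀.dualOf Θ hΘ).X.left))
  [IsSeparated A₀.X.hom]

/-! ### (γ4) FRAMES ON THE ARTINIAN LEVELS BY NILPOTENT NAKAYAMA: `FL (n+1)`/`FP (n+1)` from `FL n`/`FP n`
(B-p16 (g10) γ4-Nak `nonempty_frame_of_frame_pullback_of_nilpotent` + B-p06 (g8) γ4b `absTransitionAppLE_surjective` /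
`isNilpotent_ker_absTransitionAppLE` / `isAffineOpen_fst_preimage`) -/

section Gamma4

variable {ι : Type} (V : ι → A₀.X.left.Opens) (hV : ∀ a, IsAffineOpen (V a)) (T'' : SchemeOver ℂ) (x : T''.left)

/-- The one-step transition `A₀ × Spec(𝒪_{T,x}/𝔪^{n+1}) ↪ A₀ × Spec(𝒪_{T,x}/𝔪^{n+2})` in the α currency
(`absTransition` along `π n`). [cite: GortzWedhorn2023, Lemma 24.72 (p. 409), proof, Step (I) (p. 410)] -/
abbrev levelτ (n : ℕ) :
    pullback A₀.X.hom (thickeningPt T'' x n).hom ⟶ pullback A₀.X.hom (thickeningPt T'' x (n + 1)).hom :=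
  absTransition A₀.X (thickeningPt T'' x (n + 1)).hom (thickeningPt_hom_eq T'' x (n + 1)) (thickeningPt T'' x n).hom
    (thickeningPt_hom_eq T'' x n) (πℂ T'' x n)

omit [LocallyOfFiniteType T'.hom] [IsLocallyNoetherian T'.left] [LocallyOfFiniteType (A₀.dualOf Θ hΘ).X.hom]
  [IsLocallyNoetherian (A₀.dualOf Θ hΘ).X.left] [IsSeparated A₀.X.hom] in
/-- `levelτ n = (A₀ ◁ thickeningPtTransition n).left`. [cite: GortzWedhorn2023, Lemma 24.72 (p. 409), proof, Step (I) (p. 410)] -/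
theorem whiskerLeft_thickeningPtTransition_left_eq_levelτ (n : ℕ) :
    (A₀.X ◁ thickeningPtTransition T'' x n).left = levelτ A₀ T'' x n :=
  whiskerLeft_left_eq_absTransition A₀.X _ _ _ _ (πℂ T'' x n) (thickeningPtTransition T'' x n)
    (specMap_πℂ T'' x n).symm

/-- `π n : 𝒪/𝔪^{n+2} → 𝒪/𝔪^{n+1}` is surjective. [cite: GortzWedhorn2023, Lemma 24.72 (p. 409), proof, Step (I) (p. 410)] -/
theorem πℂ_surjective (n : ℕ) : Function.Surjective (πℂ T'' x n) := by
  intro r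
  obtain ⟨r, rfl⟩ := Ideal.Quotient.mk_surjective r
  exact ⟨Ideal.Quotient.mk _ r, rfl⟩

/-- `ker (π n)` is nilpotent (square zero). [cite: GortzWedhorn2023, Lemma 24.72 (p. 409), proof, Step (I) (p. 410)] -/
theorem isNilpotent_ker_πℂ (n : ℕ) : IsNilpotent (RingHom.ker (πℂ T'' x n)) := by
  have h : RingHom.ker (πℂ T'' x n) = thickKer T'' (topPt T'' x) n := by
    ext r
    rw [RingHom.mem_ker, πℂ_apply, thickπ_eq_zero_iff_mem]
  refine ⟨2, ?_⟩
  rw [h, thickKer_sq_eq_bot, Submodule.zero_eq_bot]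

/-- **(γ4) FRAMES CLIMB ONE LEVEL**: frames of `N ≅ τ^*N'` on the pieces `pr⁻¹V_a` of `A₀ × Spec(𝒪/𝔪^{n+1})` give
frames of the rank-one quasi-coherent `N'` on the pieces of `A₀ × Spec(𝒪/𝔪^{n+2})` — nilpotent Nakayama on the affine
chart algebras `Γ(V_a) ⊗ 𝒪/𝔪^{n+2} ↠ Γ(V_a) ⊗ 𝒪/𝔪^{n+1}` (surjective with nilpotent kernel).
[cite: GortzWedhorn2023, Lemma 24.72 (p. 409), proof, Step (I) (p. 410)] [cite: MumfordAV1970, §13 (proof of the Thm. pp. 125–130)] -/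
def framesSucc (n : ℕ) {N : (pullback A₀.X.hom (thickeningPt T'' x n).hom).Modules}
    {N' : (pullback A₀.X.hom (thickeningPt T'' x (n + 1)).hom).Modules} (hq : N'.IsQuasicoherent)
    (hN' : HasRank N' 1) (e : (Scheme.Modules.pullback (levelτ A₀ T'' x n)).obj N' ≅ N)
    (F : IFrames N (fun a => (pullback.fst A₀.X.hom (thickeningPt T'' x n).hom) ⁻¹ᵁ V a)) :
    IFrames N' (fun a => (pullback.fst A₀.X.hom (thickeningPt T'' x (n + 1)).hom) ⁻¹ᵁ V a) :=
  haveI := hq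
  ⟨fun a => (nonempty_frame_of_frame_pullback_of_nilpotent (levelτ A₀ T'' x n) N' hN'
      (isAffineOpen_fst_preimage A₀.X _ (hV a)) (isAffineOpen_fst_preimage A₀.X _ (hV a))
      (fst_preimage_le_absTransition_preimage A₀.X _ _ _ _ (πℂ T'' x n) (V a))
      (absTransitionAppLE_surjective A₀.X _ _ _ _ (πℂ T'' x n) (πℂ_surjective T'' x n) (hV a))
      (isNilpotent_ker_absTransitionAppLE A₀.X _ _ _ _ (πℂ T'' x n) (πℂ_surjective T'' x n)
        (isNilpotent_ker_πℂ T'' x n) (hV a))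
      ((F.mapIso e.symm).frame a)).some⟩

end Gamma4

section Gamma4L

variable {ι : Type} (V : ι → A₀.X.left.Opens) (hV : ∀ a, IsAffineOpen (V a))

omit [LocallyOfFiniteType T'.hom] [IsLocallyNoetherian T'.left] [LocallyOfFiniteType (A₀.dualOf Θ hΘ).X.hom]
  [IsLocallyNoetherian (A₀.dualOf Θ hΘ).X.left] [IsSeparated A₀.X.hom] in
/-- `τ n = levelτ n` for the `T`-tower. [cite: GortzWedhorn2023, Lemma 24.72 (p. 409), proof, Step (I) (p. 410)] -/
theorem τn_eq_levelτ (n : ℕ) : τn A₀ T' t n = levelτ A₀ T' t n :=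
  whiskerLeft_thickeningPtTransition_left_eq_levelτ A₀ T' t n

/-- `(levelτ n)^* L (n+1) ≅ L n`. [folklore] -/
def Llevelτ (n : ℕ) :
    (Scheme.Modules.pullback (levelτ A₀ T' t n)).obj (Ln A₀ T' ℒ t (n + 1)) ≅ Ln A₀ T' ℒ t n :=
  eqToIso (congrArg (fun k => (Scheme.Modules.pullback k).obj (Ln A₀ T' ℒ t (n + 1))) (τn_eq_levelτ A₀ T' t n).symm) ≪≫
    Lτn A₀ T' ℒ t n

/-- **`FL`: frames of `ℒ|` on every Artinian level from frames at level `0`.** [cite: MumfordAV1970, §13 (proof of the Thm. pp. 125–130)] -/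
def framesL (F0 : IFrames (Ln A₀ T' ℒ t 0) (Wn V 0)) : ∀ n, IFrames (Ln A₀ T' ℒ t n) (Wn V n)
  | 0 => F0
  | n + 1 => by
    have hqL : (show (pullback A₀.X.hom T'.hom).Modules from ℒ.L).IsQuasicoherent :=
      isQuasicoherent_of_hasRank ℒ.hasRank_one
    have hq : (Ln A₀ T' ℒ t (n + 1)).IsQuasicoherent := isQuasicoherent_pullback (rn A₀ T' t (n + 1)) ℒ.L
    exact framesSucc A₀ V hV T' t n hq (hasRank_pullback _ ℒ.hasRank_one) (Llevelτ A₀ T' ℒ t n) (framesL F0 n)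

omit [LocallyOfFiniteType T'.hom] [IsLocallyNoetherian T'.left] [LocallyOfFiniteType (A₀.dualOf Θ hΘ).X.hom]
  [IsLocallyNoetherian (A₀.dualOf Θ hΘ).X.left] [IsSeparated A₀.X.hom] in
/-- `levelτ n ≫ jB (n+1) = jB n` for the `Â`-tower. [cite: GortzWedhorn2023, Lemma 24.72 (p. 409), proof, Step (I) (p. 410)] -/
theorem levelτ_jBn (n : ℕ) : levelτ A₀ (A₀.dualOf Θ hΘ).X y₀ n ≫ jBn A₀ hΘ y₀ (n + 1) = jBn A₀ hΘ y₀ n := by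
  rw [← whiskerLeft_thickeningPtTransition_left_eq_levelτ, jBn, jBn]
  change (A₀.X ◁ thickeningPtTransition (A₀.dualOf Θ hΘ).X y₀ n ≫ A₀.X ◁ thickeningPtι (A₀.dualOf Θ hΘ).X y₀ (n + 1)).left = _
  rw [← MonoidalCategory.whiskerLeft_comp, thickeningPtTransition_comp]

/-- `(levelτ n)^* PB (n+1) ≅ PB n`. [folklore] -/
def PBlevelτ (n : ℕ) :
    (Scheme.Modules.pullback (levelτ A₀ (A₀.dualOf Θ hΘ).X y₀ n)).obj (PBn A₀ hΘ P y₀ (n + 1)) ≅ PBn A₀ hΘ P y₀ n :=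
  ((Scheme.Modules.pullbackComp (levelτ A₀ (A₀.dualOf Θ hΘ).X y₀ n) (jBn A₀ hΘ y₀ (n + 1))).app P) ≪≫
    eqToIso (congrArg (fun k => (Scheme.Modules.pullback k).obj P) (levelτ_jBn A₀ hΘ y₀ n))

/-- **`FP`: frames of `𝒫|` on every Artinian level of `Â` at `y₀` from frames at level `0`.**
[cite: MumfordAV1970, §13 (proof of the Thm. pp. 125–130)] -/
def framesP [P.IsQuasicoherent] (hP1 : HasRank P 1)
    (F0 : IFrames (PBn A₀ hΘ P y₀ 0) (fun a => (pullback.fst A₀.X.hom (sB A₀ hΘ y₀ 0)) ⁻¹ᵁ V a)) :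
    ∀ n, IFrames (PBn A₀ hΘ P y₀ n) (fun a => (pullback.fst A₀.X.hom (sB A₀ hΘ y₀ n)) ⁻¹ᵁ V a)
  | 0 => F0
  | n + 1 => by
    have hq : (PBn A₀ hΘ P y₀ (n + 1)).IsQuasicoherent := isQuasicoherent_pullback (jBn A₀ hΘ y₀ (n + 1)) P
    exact framesSucc A₀ V hV (A₀.dualOf Θ hΘ).X y₀ n hq (hasRank_pullback _ hP1) (PBlevelτ A₀ hΘ P y₀ n)
      (framesP hP1 F0 n)

end Gamma4L

end GammaInstance

end Literature.AlgebraicGeometry.Motives.AbelianVariety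

end
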